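import Literature.NumberTheory.Weil1964.ArchMetaplecticQuotientCharacter
import HarnessLib

/-!
# The value at the origin of an implementer of a Siegel element, and its square

Topic `NumberTheory/Weil1964`; namespace `Literature.NumberTheory.Weil1964.MpS`.  KERNEL MATHEMATICS ONLY: proved
theorems; no definition, no `def … : Prop` record, no axiom, no proof hole.

Continuation of `ArchMetaplecticQuotientCharacter` (the quotient character `quot y = C(y)² det P(π y)` of
`Mp^𝓢(W) = MpS σ`, `W = ℝ^σ × ℝ^σ`; `quot` is conjugation invariant and `= 1` exactly on Folland's `Mp₂(W)`).  For an
element `w ∈ Mp^𝓢(W)` lying over an element of the Siegel parabolic `P_Y = MN`,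
`π(w) = m(a, d) n(b)` (`leviSp a d · unipotentSp b`, [Folland1989, (4.24)–(4.25)]):

* `exists_eq_unitScalar_mul_levi_mul_unip`: `w = u · (levi a d · unip b)` with `|u| = 1` (Schur);
* **`apply_zero_of_proj_eq_levi_mul_unip`**: the VALUE AT THE ORIGIN `(w f)(0) = u · |det a|^{-1/2} · f(0)` for every
  `f ∈ 𝓢(ℝ^σ)` — Folland's `|det a|^{-1/2} f(a⁻¹x)` at `x = 0` and the chirp `e^{-πi x·bx} = 1` at `x = 0`
  (Weil's `d₀(α)`, `t₀(f)` [Weil1964, Chap. I n° 13]; Kudla's `ω(m(a))φ(0) = χ(det a)|det a|^{1/2}φ(0)` read in the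
  Schwartz model);
* **`sq_originScalar_eq_quot`**: when `det a > 0`, `u² = quot w` — the square of the unitary part of the origin value is
  the quotient character (`levi a d · unip b` is then metaplectic, `isMetaplectic_levi_mul_unip`), so that on SQUARES
  of Siegel elements the origin value is computed by `quot` alone, with no sign ambiguity.

## References

* [Folland1989] G. B. Folland, *Harmonic Analysis in Phase Space*, Princeton UP 1989, §4.2 (4.24)–(4.25), Thm. (4.37).
* [Weil1964] A. Weil, Acta Math. 111 (1964), Chap. I n° 13 p. 160 (`d₀(α)`, `t₀(f)`).
* [Kudla1994] S. Kudla, Israel J. Math. 87 (1994), §3 (the splitting on the Siegel parabolic).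
-/

set_option autoImplicit false

noncomputable section

open MeasureTheory Complex SchwartzMap Matrix
open scoped ComplexConjugate Real

namespace Literature.NumberTheory.Weil1964

open Literature.Analysis.SegalBargmann Literature.RepresentationTheory.HeisenbergGroup

variable {σ : Type*} [Fintype σ] [DecidableEq σ]

local notation "SR" σ => SchwartzMap (σ → ℝ) ℂ

namespace MpS

/-- **Schur over a Siegel element**: `w = u · (levi a d · unip b)`, `|u| = 1`. [cite: Folland1989, §4.2 (4.23)–(4.25)] -/
theorem exists_eq_unitScalar_mul_levi_mul_unip (w : MpS σ) (a d : (σ → ℝ) ≃ₗ[ℝ] (σ → ℝ))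
    (had : ∀ x y, dotPairing σ (a x) (d y) = dotPairing σ x y) (b : (σ → ℝ) →ₗ[ℝ] (σ → ℝ))
    (hb : ∀ x x', dotPairing σ x (b x') = dotPairing σ x' (b x))
    (h : proj w = leviSp (dotPairing σ) a d had * unipotentSp (dotPairing σ) b hb) :
    ∃ (u : ℂ) (hu : ‖u‖ = 1), w = unitScalar u hu * (levi a d had * unip b hb) :=
  exists_eq_unitScalar_mul_of_proj_eq (x := levi a d had * unip b hb) (y := w)
    (by rw [map_mul, proj_levi, proj_unip, h])

omit [DecidableEq σ] in
/-- the chirp is `1` at the origin. [cite: Folland1989, §4.2 (4.25)] -/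
theorem chirpMul_apply_zero (b : (σ → ℝ) →ₗ[ℝ] (σ → ℝ)) : chirpMul b 0 = 1 := by
  rw [chirpMul, chirpArg, zero_dotProduct, mul_zero, neg_zero, Complex.ofReal_zero, zero_mul, Complex.exp_zero]

omit [DecidableEq σ] in
/-- the value at the origin of `levi a d · unip b`: `|det a|^{-1/2} f(0)`. [cite: Folland1989, §4.2 (4.24)–(4.25)] -/
theorem levi_mul_unip_apply_zero (a d : (σ → ℝ) ≃ₗ[ℝ] (σ → ℝ)) (had : ∀ x y, dotPairing σ (a x) (d y) = dotPairing σ x y)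
    (b : (σ → ℝ) →ₗ[ℝ] (σ → ℝ)) (hb : ∀ x x', dotPairing σ x (b x') = dotPairing σ x' (b x)) (f : SR σ) :
    (levi a d had * unip b hb).1.2 f 0 = leviFactor a * f 0 := by
  rw [mul_apply]
  show leviEquiv a (chirpEquiv b f) 0 = _
  rw [leviEquiv_apply, leviS_apply, map_zero, chirpEquiv_apply, chirpS_apply, chirpMul_apply_zero, one_mul]

/-- **THE VALUE AT THE ORIGIN of an implementer of a Siegel element**: `(w f)(0) = u |det a|^{-1/2} f(0)` with `|u| = 1`
and `w = u · (levi a d · unip b)`. [cite: Folland1989, §4.2 (4.24)–(4.25); Weil1964, Chap. I n° 13] -/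
theorem apply_zero_of_proj_eq_levi_mul_unip (w : MpS σ) (a d : (σ → ℝ) ≃ₗ[ℝ] (σ → ℝ))
    (had : ∀ x y, dotPairing σ (a x) (d y) = dotPairing σ x y) (b : (σ → ℝ) →ₗ[ℝ] (σ → ℝ))
    (hb : ∀ x x', dotPairing σ x (b x') = dotPairing σ x' (b x))
    (h : proj w = leviSp (dotPairing σ) a d had * unipotentSp (dotPairing σ) b hb) :
    ∃ (u : ℂ) (hu : ‖u‖ = 1), w = unitScalar u hu * (levi a d had * unip b hb) ∧
      ∀ f : SR σ, w.1.2 f 0 = u * leviFactor a * f 0 := by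
  obtain ⟨u, hu, rfl⟩ := exists_eq_unitScalar_mul_levi_mul_unip w a d had b hb h
  refine ⟨u, hu, rfl, fun f => ?_⟩
  rw [mul_apply, unitScalar_apply, _root_.smul_apply, smul_eq_mul, levi_mul_unip_apply_zero, mul_assoc]

/-- **its square is the quotient character** (positive Levi): if `det a > 0` and `w = u · (levi a d · unip b)` then
`u² = quot w`. [cite: Folland1989, §4.2 Thm. (4.37); Kudla1994, §3] -/
theorem sq_originScalar_eq_quot {w : MpS σ} {a d : (σ → ℝ) ≃ₗ[ℝ] (σ → ℝ)}
    {had : ∀ x y, dotPairing σ (a x) (d y) = dotPairing σ x y} (hdet : 0 < LinearMap.det (a : (σ → ℝ) →ₗ[ℝ] (σ → ℝ)))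
    {b : (σ → ℝ) →ₗ[ℝ] (σ → ℝ)} {hb : ∀ x x', dotPairing σ x (b x') = dotPairing σ x' (b x)} {u : ℂ} {hu : ‖u‖ = 1}
    (hw : w = unitScalar u hu * (levi a d had * unip b hb)) : u ^ 2 = quot w := by
  rw [hw, quot_unitScalar_mul, (isMetaplectic_levi_mul_unip a d had hdet b hb).quot_eq_one, mul_one]

/-- **THE SQUARE OF THE ORIGIN VALUE** (positive Levi): for `w` over `m(a, d) n(b)` with `det a > 0` there is `u` with
`(w f)(0) = u |det a|^{-1/2} f(0)` for all `f` and `u² = quot w`; in particular the origin value of `w` is determined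
UP TO SIGN by `quot w` and `|det a|`, and for a square `w = y²` exactly. [cite: Folland1989, §4.2 (4.24)–(4.25), Thm. (4.37)] -/
theorem exists_apply_zero_and_sq_eq_quot (w : MpS σ) (a d : (σ → ℝ) ≃ₗ[ℝ] (σ → ℝ))
    (had : ∀ x y, dotPairing σ (a x) (d y) = dotPairing σ x y) (hdet : 0 < LinearMap.det (a : (σ → ℝ) →ₗ[ℝ] (σ → ℝ)))
    (b : (σ → ℝ) →ₗ[ℝ] (σ → ℝ)) (hb : ∀ x x', dotPairing σ x (b x') = dotPairing σ x' (b x))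
    (h : proj w = leviSp (dotPairing σ) a d had * unipotentSp (dotPairing σ) b hb) :
    ∃ u : ℂ, ‖u‖ = 1 ∧ u ^ 2 = quot w ∧ ∀ f : SR σ, w.1.2 f 0 = u * leviFactor a * f 0 := by
  obtain ⟨u, hu, hw, hf⟩ := apply_zero_of_proj_eq_levi_mul_unip w a d had b hb h
  exact ⟨u, hu, sq_originScalar_eq_quot hdet hw, hf⟩

omit [DecidableEq σ] in
/-- the origin value is multiplicative along products: if `(x f)(0) = c_x f(0)` and `(y f)(0) = c_y f(0)` for all `f`
then `((x y) f)(0) = c_x c_y f(0)`. [cite: Weil1964, Chap. I n° 13] -/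
theorem mul_apply_zero_of_apply_zero {x y : MpS σ} {cx cy : ℂ} (hx : ∀ f : SR σ, x.1.2 f 0 = cx * f 0)
    (hy : ∀ f : SR σ, y.1.2 f 0 = cy * f 0) (f : SR σ) : (x * y).1.2 f 0 = cx * cy * f 0 := by
  rw [mul_apply, hx, hy, mul_assoc]

end MpS

end Literature.NumberTheory.Weil1964

end
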